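import Summits.CriticalPhenomena.PercolationContinuityZ3.Theorems.FK.InfiniteVolumeClosedBoundaryFree
import Summits.CriticalPhenomena.PercolationContinuityZ3.Theorems.FK.DomainMarkovExtremalityLimits
import Literature.Probability.Percolation.ConstrainedClusters
import HarnessLib

/-!
# FK-continuity cell, FO-10a: a random-cluster box limit WITHOUT infinite clusters lies below the free
# measure — hence `φ⁰_{p,q} = φ¹_{p,q}` whenever `φ¹_{p,q}` does not percolate
# (Grimmett 2006, Thm. (5.33)(a) for `θ¹ = 0`; Aizenman–Chayes–Chayes–Newman 1988, Thm. A.2)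

Registered R73 (cell INBOX l.5522, 2026-08-23); registry row FO-10a-g335; label NPC-B (coordinator fk-4 g152).
Cell `fk-continuity` (bschramm), row FO-10a (domain-Markov + comparison layer over FO-06); support file
for the FK-continuity transplant (`--supports stmt-CriticalPhenomena-4575`); builds on p205010 (kernel
theorem, internal audit signed; external expert review pending). Pure proofs; no definitions, no named
facts, no sorries; general dimension `d`.

Grimmett 2006, §5.3, Thm. (5.33) and the sentence after it (p. 107): "there is a unique random-cluster
measure for any `p` such that `θ¹(p,q) = 0` [8, Thm A.2]". The printed route is Thm. (5.16)(c) (a monotone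
coupling of `φ⁰_{p,q}` and `φ¹_{p,q}`, Prop. (5.30)); here the case `θ¹ = 0` is proved WITHOUT couplings:

* fix an increasing event `A` determined by the edges `E_Λ` of a finite region `Λ`, and a box
  `Δ = Λ_{k+1} ⊇ Λ`; for a configuration `ω` let `R(ω)` be the set of vertices joined to `∂Δ` by an open
  path inside `Δ`, and `G(ω) = Δ ∖ R(ω)` the "free island";
* the events `{G = g}` (`g ⊆ Δ`) are determined by the edges of `Δ` NOT inside `g`
  (`determinedBy_setOf_island`), and on `{G = g}` every lattice edge leaving `g` is closed
  (`not_mem_of_island`) — so by the free domain Markov property across a closed edge boundary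
  (`IsBoxLimit.real_inter_le_of_closed`, `InfiniteVolumeClosedBoundaryFree.lean`) and the extremality
  of the free measure of a finite region ((4.21)/(4.24)), `P(A ∩ {G = g}) ≤ P'(A) · P(G = g)` for every
  box limit `P` and every measure `P'` of the sandwich class `FKGibbs d p q`;
* summing over the islands `g ⊇ Λ`: `P(A; Λ ↮ ∂Δ in Δ) ≤ P'(A)`
  (`IsBoxLimit.real_inter_setOf_forall_not_bdryReach_le`);
* if `P` has no infinite cluster, `P(Λ ↔ ∂Λ_{k+1}) → 0` as `k → ∞`, whence **`P(A) ≤ P'(A)` for every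
  increasing local `A`** (`IsBoxLimit.real_le_of_forall_percolatesAt_eq_zero`); with `P = φ¹_{p,q}`,
  `P' = φ⁰_{p,q}` and Lemma (4.14)(b): **`φ⁰_{p,q} = φ¹_{p,q}`**
  (`rcLimit_false_eq_rcLimit_true_of_forall_percolatesAt_eq_zero`), and the sandwich class is the
  singleton `{φ⁰_{p,q}}` (`FKGibbs.eq_rcLimit_false_of_forall_percolatesAt_eq_zero`, via FO-10a's (4.36)
  `FKGibbs.eq_rcLimit_of_rcLimit_false_eq_true`).

The `θ`-level statements (`θ¹(p,q) = 0`, `p < p_c(q)`, `p = p_c(q)` under `T_W(q)`) are in the companion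
`UniquenessOfNonPercolationTheta.lean`.

## References
* G. Grimmett, *The Random-Cluster Model*, Springer 2006 (`book:grimmett2006-random-cluster-model`):
  Lemma (4.13), (4.14)(b), Thm. (4.19) (4.20)–(4.21), (4.24), (4.36) [PDF pp. 71–80]; §5.3 Thm. (5.33)(a) and the
  remark after it, Conj. (5.34) [PDF p. 107]. [Grimmett2006]
* M. Aizenman, J. T. Chayes, L. Chayes, C. M. Newman, J. Stat. Phys. 50 (1988) 1–40, Thm. A.2. [AizenmanChayesChayesNewman1988]
-/

noncomputable section

open MeasureTheory Set Filter
open scoped Topology ENNReal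

namespace Summit.CriticalPhenomena.PercolationContinuityZ3.Theorems.FK

open Literature.Probability.Percolation Literature.Probability.LatticeModels

/-! ## The free island of a configuration in a finite region `Δ ⊆ ℤ^d`

For `ω` and a finite `Δ`, a vertex `x` is *joined to `∂Δ` inside `Δ`* if
`∃ y ∈ ∂Δ, (openGraph ω ⊓ withinGraph (zdGraph d) Δ).Reachable y x` (an open lattice path inside `Δ`);
the *free island* is the set of vertices of `Δ` not so joined. We do not name these notions; the event
"the free island is `g`" is written `{ω | ∀ x, x ∈ g ↔ x ∈ Δ ∧ ¬ (x joined to ∂Δ inside Δ)}`. -/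

section Island

variable {d : ℕ}

/-- A lattice step inside `Δ` between two vertices, the first joined to `∂Δ` inside `Δ`, is one of the edges
`E_Δ ∖ E_g` whenever `g` is the free island (the first vertex is off `g`). [cite: Grimmett2006, §5.2, proof of Thm. (5.16)(c) (the set G)] -/
theorem mk_mem_edgesIn_sdiff_of_island {Δ g : Finset (Site d)} {ω : BondConfig (Site d)}
    (hg : ∀ x, x ∈ g ↔ x ∈ Δ ∧ ¬ ∃ y ∈ innerBoundary (zdGraph d) Δ,
      (openGraph ω ⊓ withinGraph (zdGraph d) (↑Δ : Set (Site d))).Reachable y x)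
    {a b : Site d} (ha : ∃ y ∈ innerBoundary (zdGraph d) Δ,
      (openGraph ω ⊓ withinGraph (zdGraph d) (↑Δ : Set (Site d))).Reachable y a)
    (hab : (zdGraph d).Adj a b) (haΔ : a ∈ Δ) (hbΔ : b ∈ Δ) :
    s(a, b) ∈ edgesIn (zdGraph d) Δ \ edgesIn (zdGraph d) g := by
  rw [Finset.mem_sdiff, mem_edgesIn_iff, mem_edgesIn_iff]
  refine ⟨⟨(SimpleGraph.mem_edgeSet _).2 hab, fun z hz => ?_⟩, fun h => ?_⟩
  · rcases Sym2.mem_iff.1 hz with rfl | rfl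
    · exact haΔ
    · exact hbΔ
  · exact ((hg a).1 (h.2 a (Sym2.mem_mk_left a b))).2 ha

/-- **The free island does not see the configuration inside itself**: if two configurations agree on the
edges `E_Δ ∖ E_g` and `g` is the free island of the first, then the two configurations join the same
vertices to `∂Δ` inside `Δ`. [cite: Grimmett2006, §5.2, proof of Thm. (5.16)(c) (conditional on G, "G = g" is measurable outside g)] -/
theorem bdryReach_iff_of_island {Δ g : Finset (Site d)} {ω₁ ω₂ : BondConfig (Site d)}
    (hg : ∀ x, x ∈ g ↔ x ∈ Δ ∧ ¬ ∃ y ∈ innerBoundary (zdGraph d) Δ,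
      (openGraph ω₁ ⊓ withinGraph (zdGraph d) (↑Δ : Set (Site d))).Reachable y x)
    (h12 : ∀ e ∈ edgesIn (zdGraph d) Δ \ edgesIn (zdGraph d) g, e ∈ ω₁ ↔ e ∈ ω₂) (x : Site d) :
    (∃ y ∈ innerBoundary (zdGraph d) Δ,
        (openGraph ω₂ ⊓ withinGraph (zdGraph d) (↑Δ : Set (Site d))).Reachable y x) ↔
      ∃ y ∈ innerBoundary (zdGraph d) Δ,
        (openGraph ω₁ ⊓ withinGraph (zdGraph d) (↑Δ : Set (Site d))).Reachable y x := by
  -- the set of vertices joined to `∂Δ` inside `Δ` in `ω₁`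
  set r : Set (Site d) := {a | ∃ y ∈ innerBoundary (zdGraph d) Δ,
    (openGraph ω₁ ⊓ withinGraph (zdGraph d) (↑Δ : Set (Site d))).Reachable y a} with hr
  -- `r` is closed under the steps of `ω₁` inside `Δ`
  have hr₁ : ∀ ⦃a b : Site d⦄, a ∈ r →
      (openGraph ω₁ ⊓ withinGraph (zdGraph d) (↑Δ : Set (Site d))).Adj a b → b ∈ r := by
    rintro a b ⟨y, hy, hya⟩ hab
    exact ⟨y, hy, hya.trans hab.reachable⟩
  -- a step of `ω₁` inside `Δ` out of `r` is an edge of `E_Δ ∖ E_g`, hence also a step of `ω₂`; and conversely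
  have step : ∀ ⦃a b : Site d⦄, a ∈ r → (zdGraph d).Adj a b → a ∈ Δ → b ∈ Δ →
      (s(a, b) ∈ ω₁ ↔ s(a, b) ∈ ω₂) := fun a b ha hab haΔ hbΔ =>
    h12 _ (mk_mem_edgesIn_sdiff_of_island hg ha hab haΔ hbΔ)
  have ht₁ : ∀ ⦃a b : Site d⦄, a ∈ r →
      (openGraph ω₁ ⊓ withinGraph (zdGraph d) (↑Δ : Set (Site d))).Adj a b →
      (openGraph ω₂ ⊓ withinGraph (zdGraph d) (↑Δ : Set (Site d))).Adj a b := by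
    intro a b ha hab
    rw [SimpleGraph.inf_adj, openGraph_adj, withinGraph_adj] at hab ⊢
    exact ⟨⟨(step ha hab.2.1 hab.2.2.1 hab.2.2.2).1 hab.1.1, hab.1.2⟩, hab.2⟩
  -- `r` is closed under the steps of `ω₂` inside `Δ` as well
  have hr₂ : ∀ ⦃a b : Site d⦄, a ∈ r →
      (openGraph ω₂ ⊓ withinGraph (zdGraph d) (↑Δ : Set (Site d))).Adj a b → b ∈ r := by
    intro a b ha hab
    rw [SimpleGraph.inf_adj, openGraph_adj, withinGraph_adj] at hab
    refine hr₁ ha ?_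
    rw [SimpleGraph.inf_adj, openGraph_adj, withinGraph_adj]
    exact ⟨⟨(step ha hab.2.1 hab.2.2.1 hab.2.2.2).2 hab.1.1, hab.1.2⟩, hab.2⟩
  constructor
  · rintro ⟨y, hy, hyx⟩
    have hyr : y ∈ r := ⟨y, hy, SimpleGraph.Reachable.refl _⟩
    exact mem_of_reachable_of_forall_adj_mem hr₂ hyr hyx
  · rintro ⟨y, hy, ⟨w⟩⟩
    have hyr : y ∈ r := ⟨y, hy, SimpleGraph.Reachable.refl _⟩
    exact ⟨y, hy, reachable_of_walk_of_forall_adj hr₁ ht₁ hyr w⟩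

/-- **The event "the free island of `Δ` is `g`" is determined by the edges `E_Δ ∖ E_g`** (the lattice
edges inside `Δ` not inside `g`). [cite: Grimmett2006, §5.2, proof of Thm. (5.16)(c) (conditional on G)] -/
theorem determinedBy_setOf_island (Δ g : Finset (Site d)) :
    DeterminedBy {ω : BondConfig (Site d) | ∀ x, x ∈ g ↔ x ∈ Δ ∧ ¬ ∃ y ∈ innerBoundary (zdGraph d) Δ,
        (openGraph ω ⊓ withinGraph (zdGraph d) (↑Δ : Set (Site d))).Reachable y x}
      ↑(edgesIn (zdGraph d) Δ \ edgesIn (zdGraph d) g) := by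
  rw [determinedBy_iff]
  intro ω₁ ω₂ h
  have h12 : ∀ e ∈ edgesIn (zdGraph d) Δ \ edgesIn (zdGraph d) g, e ∈ ω₁ ↔ e ∈ ω₂ := by
    intro e he
    have := Set.ext_iff.1 h e
    simp only [Set.mem_inter_iff, Finset.mem_coe] at this
    exact ⟨fun h1 => (this.1 ⟨h1, he⟩).1, fun h2 => (this.2 ⟨h2, he⟩).1⟩
  simp only [Set.mem_setOf_eq]
  constructor
  · intro hg x
    rw [bdryReach_iff_of_island hg h12 x]
    exact hg x
  · intro hg x
    rw [bdryReach_iff_of_island hg (fun e he => (h12 e he).symm) x]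
    exact hg x

/-- **On "the free island is `g`", every lattice edge leaving `g` is closed**: an open edge from `x ∈ g`
to `y ∉ g` would join `x` to `∂Δ` inside `Δ` (through `y`, which lies in `Δ` because `x ∉ ∂Δ`).
[cite: Grimmett2006, §5.2, proof of Thm. (5.16)(c) (the edges leaving G are closed)] -/
theorem not_mem_of_island {Δ g : Finset (Site d)} {ω : BondConfig (Site d)}
    (hg : ∀ x, x ∈ g ↔ x ∈ Δ ∧ ¬ ∃ y ∈ innerBoundary (zdGraph d) Δ,
      (openGraph ω ⊓ withinGraph (zdGraph d) (↑Δ : Set (Site d))).Reachable y x)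
    {x : Site d} (hx : x ∈ g) {y : Site d} (hy : y ∉ g) (hxy : (zdGraph d).Adj x y) : s(x, y) ∉ ω := by
  intro hopen
  obtain ⟨hxΔ, hxR⟩ := (hg x).1 hx
  -- `x` is not on `∂Δ`, so its neighbour `y` lies in `Δ`
  have hyΔ : y ∈ Δ := by
    by_contra hyΔ
    have hxb : x ∈ innerBoundary (zdGraph d) Δ := mem_innerBoundary_iff.2 ⟨hxΔ, y, hyΔ, hxy⟩
    exact hxR ⟨x, hxb, SimpleGraph.Reachable.refl _⟩
  -- `y ∈ Δ ∖ g` is joined to `∂Δ` inside `Δ`, and then so is `x` through the open edge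
  have hyR : ∃ z ∈ innerBoundary (zdGraph d) Δ,
      (openGraph ω ⊓ withinGraph (zdGraph d) (↑Δ : Set (Site d))).Reachable z y := by
    by_contra hyR
    exact hy ((hg y).2 ⟨hyΔ, hyR⟩)
  obtain ⟨z, hz, hzy⟩ := hyR
  refine hxR ⟨z, hz, hzy.trans (SimpleGraph.Adj.reachable ?_)⟩
  rw [SimpleGraph.inf_adj, openGraph_adj, withinGraph_adj]
  exact ⟨⟨by rw [Sym2.eq_swap]; exact hopen, hxy.symm.ne⟩, hxy.symm, Finset.mem_coe.2 hyΔ, Finset.mem_coe.2 hxΔ⟩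

/-- Two different islands give disjoint events. [folklore] -/
theorem disjoint_setOf_island (Δ : Finset (Site d)) {g g' : Finset (Site d)} (hne : g ≠ g') :
    Disjoint {ω : BondConfig (Site d) | ∀ x, x ∈ g ↔ x ∈ Δ ∧ ¬ ∃ y ∈ innerBoundary (zdGraph d) Δ,
        (openGraph ω ⊓ withinGraph (zdGraph d) (↑Δ : Set (Site d))).Reachable y x}
      {ω | ∀ x, x ∈ g' ↔ x ∈ Δ ∧ ¬ ∃ y ∈ innerBoundary (zdGraph d) Δ,
        (openGraph ω ⊓ withinGraph (zdGraph d) (↑Δ : Set (Site d))).Reachable y x} := by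
  rw [Set.disjoint_left]
  intro ω hω hω'
  exact hne (Finset.ext fun x => (hω x).trans (hω' x).symm)

/-- **Partition by the free island**: for `Λ ⊆ Δ`, "no vertex of `Λ` is joined to `∂Δ` inside `Δ`" is the
disjoint union over `g ⊆ Δ` with `Λ ⊆ g` of "the free island is `g`". [cite: Grimmett2006, §5.2, proof of Thm. (5.16)(c) (summing over g ∈ 𝒢)] -/
theorem setOf_forall_not_bdryReach_eq_biUnion {Λ Δ : Finset (Site d)} (hΛΔ : Λ ⊆ Δ) :
    {ω : BondConfig (Site d) | ∀ x ∈ Λ, ¬ ∃ y ∈ innerBoundary (zdGraph d) Δ,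
        (openGraph ω ⊓ withinGraph (zdGraph d) (↑Δ : Set (Site d))).Reachable y x} =
      ⋃ g ∈ Δ.powerset.filter (fun g => Λ ⊆ g),
        {ω | ∀ x, x ∈ g ↔ x ∈ Δ ∧ ¬ ∃ y ∈ innerBoundary (zdGraph d) Δ,
          (openGraph ω ⊓ withinGraph (zdGraph d) (↑Δ : Set (Site d))).Reachable y x} := by
  classical
  ext ω
  simp only [Set.mem_setOf_eq, Set.mem_iUnion, Finset.mem_filter, Finset.mem_powerset, exists_prop]
  constructor
  · intro h
    refine ⟨Δ.filter fun x => ¬ ∃ y ∈ innerBoundary (zdGraph d) Δ,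
        (openGraph ω ⊓ withinGraph (zdGraph d) (↑Δ : Set (Site d))).Reachable y x,
      ⟨Finset.filter_subset _ _, fun x hx => Finset.mem_filter.2 ⟨hΛΔ hx, h x hx⟩⟩, fun x => ?_⟩
    rw [Finset.mem_filter]
  · rintro ⟨g, ⟨-, hΛg⟩, hg⟩ x hx
    exact ((hg x).1 (hΛg hx)).2

end Island

/-! ## The estimate: inside the free islands a box limit is bounded by any sandwich measure -/

section Estimate

variable {d : ℕ} {b : Bool} {p q : ℝ} {P P' : Measure (BondConfig (Site d))}

/-- **Summing over the free islands**: for a box limit `P` (`IsBoxLimit d b p q P`, `0 ≤ p ≤ 1`, `q > 0`), a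
measure `P'` of the sandwich class `FKGibbs d p q P'`, finite `Λ ⊆ Δ` and an increasing event `A` determined
by `E_Λ`: `P(A ∩ {no vertex of Λ is joined to ∂Δ inside Δ}) ≤ P'(A)`. On each island `g ⊇ Λ` the
configuration is free (`IsBoxLimit.real_inter_le_of_closed`) and `φ⁰_g(A) ≤ P'(A)`.
[cite: Grimmett2006, §5.2 proof of Thm. (5.16)(c) with Lemma (4.13) and (4.21)/(4.24)] -/
theorem IsBoxLimit.real_inter_setOf_forall_not_bdryReach_le (hP : IsBoxLimit d b p q P)
    (hp : p ∈ Set.Icc (0 : ℝ) 1) (hq : 0 < q) (hP' : FKGibbs d p q P') {Λ Δ : Finset (Site d)}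
    (hΛΔ : Λ ⊆ Δ) {A : Set (BondConfig (Site d))} (hA : IsUpperSet A)
    (hAΛ : DeterminedBy A ↑(edgesIn (zdGraph d) Λ)) :
    P.real (A ∩ {ω | ∀ x ∈ Λ, ¬ ∃ y ∈ innerBoundary (zdGraph d) Δ,
        (openGraph ω ⊓ withinGraph (zdGraph d) (↑Δ : Set (Site d))).Reachable y x}) ≤ P'.real A := by
  classical
  haveI := hP.isProbabilityMeasure
  -- the islands and their events
  set I : Finset (Site d) → Set (BondConfig (Site d)) := fun g =>
    {ω | ∀ x, x ∈ g ↔ x ∈ Δ ∧ ¬ ∃ y ∈ innerBoundary (zdGraph d) Δ,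
      (openGraph ω ⊓ withinGraph (zdGraph d) (↑Δ : Set (Site d))).Reachable y x} with hI
  set 𝒢 : Finset (Finset (Site d)) := Δ.powerset.filter (fun g => Λ ⊆ g) with h𝒢
  have hIm : ∀ g, MeasurableSet (I g) := fun g =>
    measurableSet_of_isLocalEvent_holds ⟨_, determinedBy_setOf_island Δ g⟩
  have hdisj : (↑𝒢 : Set (Finset (Site d))).PairwiseDisjoint I := fun g _ g' _ hne =>
    disjoint_setOf_island Δ hne
  have hdisjA : (↑𝒢 : Set (Finset (Site d))).PairwiseDisjoint (fun g => A ∩ I g) := fun g hg g' hg' hne =>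
    (hdisj hg hg' hne).mono Set.inter_subset_right Set.inter_subset_right
  have hAm : MeasurableSet A := measurableSet_of_isLocalEvent_holds ⟨_, hAΛ⟩
  -- each island term: `P(A ∩ {G = g}) ≤ P'(A) · P(G = g)`
  have hterm : ∀ g ∈ 𝒢, P.real (A ∩ I g) ≤ P'.real A * P.real (I g) := by
    intro g hg
    rw [h𝒢, Finset.mem_filter, Finset.mem_powerset] at hg
    refine hP.real_inter_le_of_closed hp hq hP' g (edgesIn (zdGraph d) Δ \ edgesIn (zdGraph d) g) hA
      (hAΛ.mono (edgesIn_subset_edgesIn_of_subset hg.2)) ?_ (determinedBy_setOf_island Δ g) ?_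
    · rw [Finset.coe_sdiff]
      exact disjoint_sdiff_left
    · intro ω hω x hx y hy hxy
      exact not_mem_of_island hω hx hy hxy
  rw [setOf_forall_not_bdryReach_eq_biUnion hΛΔ, Set.inter_iUnion₂]
  change P.real (⋃ g ∈ 𝒢, A ∩ I g) ≤ P'.real A
  rw [measureReal_biUnion_finset hdisjA (fun g _ => hAm.inter (hIm g))]
  calc ∑ g ∈ 𝒢, P.real (A ∩ I g) ≤ ∑ g ∈ 𝒢, P'.real A * P.real (I g) := Finset.sum_le_sum hterm
    _ = P'.real A * P.real (⋃ g ∈ 𝒢, I g) := by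
        rw [← Finset.mul_sum, measureReal_biUnion_finset hdisj (fun g _ => hIm g)]
    _ ≤ P'.real A * 1 := mul_le_mul_of_nonneg_left measureReal_le_one measureReal_nonneg
    _ = P'.real A := mul_one _

end Estimate

/-! ## The theorem: no infinite cluster ⇒ below every sandwich measure on increasing local events -/

section Main

variable {d : ℕ} {b : Bool} {p q : ℝ} {P P' : Measure (BondConfig (Site d))}

/-- **A box limit without infinite clusters lies below every sandwich measure on increasing local events**
(Grimmett 2006, Thm. (5.33)(a) / [ACCN88, Thm. A.2], coupling-free form): if `P` is a box limit
(`IsBoxLimit d b p q P`, `0 ≤ p ≤ 1`, `q > 0`) with `P(x ↔ ∞) = 0` at every site, then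
`P(A) ≤ P'(A)` for every `FKGibbs d p q P'` and every increasing event `A` determined by the edges of a
finite region. Proof: `P(A) ≤ P(A; Λ ↮ ∂Λ_{k+1}) + ∑_{x ∈ Λ} P(x ↔ Λ_kᶜ)`; the first term is `≤ P'(A)` by
`IsBoxLimit.real_inter_setOf_forall_not_bdryReach_le`, the second tends to `∑_x P(x ↔ ∞) = 0`.
[cite: Grimmett2006, Thm. (5.33)(a) and the remark after it (θ¹ = 0 ⇒ uniqueness, [8, Thm A.2])] -/
theorem IsBoxLimit.real_le_of_forall_percolatesAt_eq_zero (hP : IsBoxLimit d b p q P)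
    (hp : p ∈ Set.Icc (0 : ℝ) 1) (hq : 0 < q) (hperc : ∀ x : Site d, P (percolatesAt x) = 0)
    (hP' : FKGibbs d p q P') {A : Set (BondConfig (Site d))} {Λ : Finset (Site d)} (hA : IsUpperSet A)
    (hAΛ : DeterminedBy A ↑(edgesIn (zdGraph d) Λ)) : P.real A ≤ P'.real A := by
  classical
  haveI := hP.isProbabilityMeasure
  -- the events `{x ↔ Λ_kᶜ}`: some vertex off the box `Λ_k` lies in the open cluster of `x`
  set C : ℕ → Site d → Set (BondConfig (Site d)) := fun k x =>
    ⋃ z ∈ (↑(box d k) : Set (Site d))ᶜ, openConn x z with hC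
  have hCm : ∀ k x, MeasurableSet (C k x) := fun k x =>
    MeasurableSet.biUnion (Set.to_countable _) fun z _ => measurableSet_openConn_holds x z
  have hCanti : ∀ x, Antitone fun k => C k x := by
    intro x k l hkl ω hω
    simp only [hC, Set.mem_iUnion, Set.mem_compl_iff, Finset.mem_coe, exists_prop] at hω ⊢
    obtain ⟨z, hz, hωz⟩ := hω
    exact ⟨z, fun h => hz (box_mono d hkl h), hωz⟩
  -- `⋂_k {x ↔ Λ_kᶜ} ⊆ {x ↔ ∞}`: a cluster leaving every box is infinite
  have hCsub : ∀ x, (⋂ k, C k x) ⊆ percolatesAt x := by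
    intro x ω hω
    simp only [Set.mem_iInter, hC, Set.mem_iUnion, Set.mem_compl_iff, Finset.mem_coe, exists_prop] at hω
    intro hfin
    obtain ⟨z, hz, hωz⟩ := hω (hfin.toFinset.sup siteRad)
    exact hz (subset_box_of_sup_siteRad_le le_rfl (hfin.mem_toFinset.2 hωz))
  have hClim : ∀ x, Tendsto (fun k => P.real (C k x)) atTop (𝓝 0) := by
    intro x
    have h1 : Tendsto (fun k => P (C k x)) atTop (𝓝 (P (⋂ k, C k x))) :=
      tendsto_measure_iInter_atTop (fun k => (hCm k x).nullMeasurableSet) (hCanti x) ⟨0, measure_ne_top _ _⟩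
    have h0 : P (⋂ k, C k x) = 0 := measure_mono_null (hCsub x) (hperc x)
    rw [h0] at h1
    have h2 := (ENNReal.tendsto_toReal ENNReal.zero_ne_top).comp h1
    rw [ENNReal.toReal_zero] at h2
    exact h2.congr fun k => rfl
  -- the bound at level `k`
  have hbound : ∀ k, Λ.sup siteRad ≤ k → P.real A ≤ P'.real A + ∑ x ∈ Λ, P.real (C k x) := by
    intro k hk
    have hΛΔ : Λ ⊆ box d (k + 1) := subset_box_of_sup_siteRad_le (by omega)
    set E : Set (BondConfig (Site d)) := {ω | ∀ x ∈ Λ, ¬ ∃ y ∈ innerBoundary (zdGraph d) (box d (k + 1)),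
      (openGraph ω ⊓ withinGraph (zdGraph d) (↑(box d (k + 1)) : Set (Site d))).Reachable y x} with hE
    have h1 : P.real (A ∩ E) ≤ P'.real A :=
      hP.real_inter_setOf_forall_not_bdryReach_le hp hq hP' hΛΔ hA hAΛ
    -- off `E` some `x ∈ Λ` is joined to `∂Λ_{k+1}`, a vertex off `Λ_k`
    have hEc : Eᶜ ⊆ ⋃ x ∈ Λ, C k x := by
      intro ω hω
      rw [Set.mem_compl_iff, hE, Set.mem_setOf_eq] at hω
      push Not at hω
      obtain ⟨x, hx, y, hy, hyx⟩ := hω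
      simp only [Set.mem_iUnion, hC, Set.mem_compl_iff, Finset.mem_coe, exists_prop]
      refine ⟨x, hx, y, fun hyk => notMem_innerBoundary_box_of_mem_box (Nat.lt_succ_self k) hyk hy, ?_⟩
      exact (hyx.mono inf_le_left).symm
    calc P.real A ≤ P.real (A ∩ E ∪ Eᶜ) := by
          refine measureReal_mono fun ω hω => ?_
          by_cases hωE : ω ∈ E
          · exact Or.inl ⟨hω, hωE⟩
          · exact Or.inr hωE
      _ ≤ P.real (A ∩ E) + P.real Eᶜ := measureReal_union_le _ _
      _ ≤ P'.real A + P.real (⋃ x ∈ Λ, C k x) :=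
          add_le_add h1 (measureReal_mono hEc (measure_ne_top _ _))
      _ ≤ P'.real A + ∑ x ∈ Λ, P.real (C k x) := by
          gcongr
          exact measureReal_biUnion_finset_le _ _
  -- let `k → ∞`
  have hlim : Tendsto (fun k => P'.real A + ∑ x ∈ Λ, P.real (C k x)) atTop (𝓝 (P'.real A + ∑ x ∈ Λ, (0 : ℝ))) :=
    tendsto_const_nhds.add (tendsto_finsetSum Λ fun x _ => hClim x)
  rw [Finset.sum_const_zero, add_zero] at hlim
  exact ge_of_tendsto hlim (Filter.eventually_atTop.2 ⟨Λ.sup siteRad, hbound⟩)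

/-- **`φ¹_{p,q} ≤ P'` on increasing local events when `φ¹_{p,q}` has no infinite cluster** (`0 ≤ p ≤ 1`,
`q ≥ 1`, every `FKGibbs d p q P'`, e.g. `P' = φ⁰_{p,q}`). [cite: Grimmett2006, Thm. (5.33)(a) and the remark after it] -/
theorem rcLimit_true_real_le_of_forall_percolatesAt_eq_zero (hp : p ∈ Set.Icc (0 : ℝ) 1) (hq : 1 ≤ q)
    (hperc : ∀ x : Site d, rcLimit d true p q (percolatesAt x) = 0) (hP' : FKGibbs d p q P')
    {A : Set (BondConfig (Site d))} {Λ : Finset (Site d)} (hA : IsUpperSet A)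
    (hAΛ : DeterminedBy A ↑(edgesIn (zdGraph d) Λ)) : (rcLimit d true p q).real A ≤ P'.real A :=
  (isBoxLimit_rcLimit true hp hq).real_le_of_forall_percolatesAt_eq_zero hp (one_pos.trans_le hq) hperc hP'
    hA hAΛ

/-- **Grimmett 2006, Thm. (5.33)(a) for a non-percolating wired phase / [ACCN88, Thm. A.2]**: if the wired
infinite-volume measure `φ¹_{p,q}` on `ℤ^d` has no infinite cluster (`φ¹_{p,q}(x ↔ ∞) = 0` at every site;
`0 ≤ p ≤ 1`, `q ≥ 1`, every `d`), then **`φ⁰_{p,q} = φ¹_{p,q}`**. [cite: Grimmett2006, Thm. (5.33)(a) and the remark after it (p. 107)] -/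
theorem rcLimit_false_eq_rcLimit_true_of_forall_percolatesAt_eq_zero (hp : p ∈ Set.Icc (0 : ℝ) 1)
    (hq : 1 ≤ q) (hperc : ∀ x : Site d, rcLimit d true p q (percolatesAt x) = 0) :
    rcLimit d false p q = rcLimit d true p q := by
  classical
  rcases Nat.eq_zero_or_pos d with hd | hd
  · exact (rcLimit_eq_false_of_eq_zero hd true p q).symm
  haveI := isProbabilityMeasure_rcLimit false p q (d := d)
  haveI := isProbabilityMeasure_rcLimit true p q (d := d)
  have hG0 : FKGibbs d p q (rcLimit d false p q) := (isBoxLimit_rcLimit false hp hq).fkGibbs hp hq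
  have hG1 : FKGibbs d p q (rcLimit d true p q) := (isBoxLimit_rcLimit true hp hq).fkGibbs hp hq
  refine ext_of_setOf_subset fun E₀ => ?_
  have hAu : IsUpperSet {ω : BondConfig (Site d) | (↑E₀ : Set (Sym2 (Site d))) ⊆ ω} :=
    fun ω ω' hle hω => Set.Subset.trans hω hle
  have hle : (rcLimit d false p q).real {ω | (↑E₀ : Set (Sym2 (Site d))) ⊆ ω} ≤
      (rcLimit d true p q).real {ω | (↑E₀ : Set (Sym2 (Site d))) ⊆ ω} :=
    rcLimit_real_false_le_true hp hq ⟨E₀, determinedBy_setOf_subset E₀⟩ hAu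
  have hge : (rcLimit d true p q).real {ω | (↑E₀ : Set (Sym2 (Site d))) ⊆ ω} ≤
      (rcLimit d false p q).real {ω | (↑E₀ : Set (Sym2 (Site d))) ⊆ ω} := by
    by_cases hE₀ : (↑E₀ : Set (Sym2 (Site d))) ⊆ (zdGraph d).edgeSet
    · -- a lattice cylinder is determined by the edges of the box spanned by its pairs
      refine rcLimit_true_real_le_of_forall_percolatesAt_eq_zero hp hq hperc hG0 hAu
        (Λ := box d (E₀.sup pairRad)) ((determinedBy_setOf_subset E₀).mono fun e he => ?_)
      rw [Finset.mem_coe, mem_edgesIn_iff]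
      exact ⟨hE₀ he, mem_box_of_pairRad_le (Finset.le_sup (Finset.mem_coe.1 he))⟩
    · -- a non-lattice pair is almost surely closed
      rw [Set.not_subset] at hE₀
      obtain ⟨e, he, heE⟩ := hE₀
      have h0 : (rcLimit d true p q).real {ω | (↑E₀ : Set (Sym2 (Site d))) ⊆ ω} = 0 := by
        rw [measureReal_eq_zero_iff]
        refine measure_mono_null (fun ω hω => ?_) (ae_iff.1 hG1.ae_subset_edgeSet)
        exact fun hωE => heE (hωE (hω he))
      rw [h0]
      exact measureReal_nonneg
  exact (ENNReal.toReal_eq_toReal_iff' (measure_ne_top _ _) (measure_ne_top _ _)).1 (le_antisymm hle hge)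

/-- Hence the sandwich class is a singleton: every `FKGibbs d p q` measure equals `φ⁰_{p,q}` (Grimmett's
`|W_{p,q}| = |R_{p,q}| = 1` read on the cell's class; FO-10a's (4.36) `FKGibbs.eq_rcLimit_of_rcLimit_false_eq_true`).
[cite: Grimmett2006, Thm. (5.33)(a) with Thm. (4.34) eq. (4.36)] -/
theorem FKGibbs.eq_rcLimit_false_of_forall_percolatesAt_eq_zero (hP : FKGibbs d p q P)
    (hp : p ∈ Set.Icc (0 : ℝ) 1) (hq : 1 ≤ q) (hperc : ∀ x : Site d, rcLimit d true p q (percolatesAt x) = 0) :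
    P = rcLimit d false p q :=
  hP.eq_rcLimit_of_rcLimit_false_eq_true hp hq
    (rcLimit_false_eq_rcLimit_true_of_forall_percolatesAt_eq_zero hp hq hperc)

end Main

end Summit.CriticalPhenomena.PercolationContinuityZ3.Theorems.FK

end
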